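import Mathlib
import HarnessLib
import Summits.KontsevichZagierPeriods.Zeta5Search.BarnesEulerIntegralCut
import Summits.KontsevichZagierPeriods.Zeta5Search.GammaRatioUniform
import Summits.KontsevichZagierPeriods.Zeta5Search.VWPBarnesShift

/-!
# ζ(5) search — the inner Barnes integrals of the corrected induction step: evaluation and a bound uniform in `μ` (cell `pub-zeta5`, ct-1 g28)

HONEST FRAMING: systematic search; no irrationality claim unless kernel-certified.  Identities / estimates of special functions
(Mellin–Barnes); nothing here is an irrationality result, a worthiness exponent or a denominator statement; no named fact is
discharged; no definition is introduced.

Brick B6c (first part) of `HOME/ct-1/g28/VWP-BLUEPRINT-g28.md` §3 (d)–(e).  After peeling the first variable and inserting the inductive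
hypothesis, the `t`-integrand of the step is `Γ(h₁+s)Γ(h₂+s)e^{iεπs} · Σ_μ d_μ Γ(μ−s)/Γ(1+h₀+μ+s)`, `s = −t₀+iy`.  Termwise:

* `exp_phase_nat` — `e^{iεπμ} = (−1)^μ` for `ε = ±1`;
* **`inner_barnes_eq`** — `(1/2π)∫ Γ(α+s)Γ(β+s)Γ(μ−s)/Γ(c+μ+s)·e^{iεπs} dy = (−1)^μ Γ(α+μ)Γ(β+μ)Γ(c−α−β)/(Γ(c−β+μ)Γ(c−α+μ))`
  (`0 < t₀ < Re α, Re β`, `Re α + Re β < Re c`, `ε = ±1`): g27's `barnes_exp_eq_Gamma` (Lemma 2 at `z = 1`) on the line `Re s' = −(t₀+μ)`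
  after `s = s' + μ` — NO contour shift;
* `norm_inner_le` — for REAL `c ≥ 2t₀`: ‖integrand‖ ≤ C·‖Γ(α+s)Γ(β+s)‖e^{π|y|}·‖(c−t₀+μ)+iy‖^{−(c−2t₀)}, UNIFORMLY in `μ` and `y`
  (`GammaRatioUniform.exists_norm_Gamma_conj_div_le`);
* `integrable_two_Gamma_weight` — `y ↦ ‖Γ(α+s)Γ(β+s)(1+|y|)^{−q}‖e^{π|y|}` is integrable for `q > Re α + Re β − 2t₀` (two-sided Stirling);
* **`exists_integral_norm_inner_le`** — `∫‖integrand_μ‖ dy ≤ C (c−t₀+μ)^{−(c−2t₀)θ}` for every `μ`, whenever `0 ≤ θ ≤ 1` and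
  `Re α + Re β − 2t₀ < (c−2t₀)(1−θ)` (split `‖w‖^{−d} ≤ (Re w)^{−dθ}((1+|y|)/2)^{−d(1−θ)}`) — the `μ`-uniform input of the `Σ_μ ∫` swap.

Theorems only; imports `BarnesEulerIntegralCut`, `GammaRatioUniform`, `VWPBarnesShift`.
-/

noncomputable section

namespace Summit.KontsevichZagierPeriods.Zeta5Search.VWPInnerBarnes

open MeasureTheory Set Filter
open scoped Real
open Summit.KontsevichZagierPeriods.Zeta5Search.BarnesKernelBounds (norm_Gamma_shift_le)
open Summit.KontsevichZagierPeriods.Zeta5Search.BarnesMellin (ne_neg_nat_of_re_pos)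
open Summit.KontsevichZagierPeriods.Zeta5Search.VWPBarnesKernel (integrable_norm_mul_exp_pi_of_tail)
open Summit.KontsevichZagierPeriods.Zeta5Search.VWPBarnesShift (norm_phase_le)
open Summit.KontsevichZagierPeriods.Zeta5Search.GammaRatioUniform (exists_norm_Gamma_conj_div_le)

variable {t₀ : ℝ} {α β : ℂ}

/-! ### 1. The evaluation -/

/-- `e^{iεπμ} = (−1)^μ` for `ε = ±1` and a natural number `μ`. -/
theorem exp_phase_nat {ε : ℝ} (hε : ε = 1 ∨ ε = -1) (μ : ℕ) : Complex.exp (ε * π * Complex.I * μ) = (-1 : ℂ) ^ μ := by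
  rcases hε with rfl | rfl
  · rw [← Complex.exp_pi_mul_I, ← Complex.exp_nat_mul]; push_cast; ring_nf
  · rw [show ((-1 : ℝ) : ℂ) * π * Complex.I * μ = -(μ * (π * Complex.I)) by push_cast; ring, Complex.exp_neg,
      Complex.exp_nat_mul, Complex.exp_pi_mul_I, ← inv_pow, inv_neg_one]

/-- **The inner Barnes integral of the induction step** [Lemma 2 at `z = 1`, i.e. Gauss/Beta in Barnes form; Zudilin math/0206177,
Lemma 2; Nesterenko 2003 §3.2]: for `0 < t₀ < Re α`, `t₀ < Re β`, `Re α + Re β < Re c`, `ε = ±1` and `μ : ℕ`,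
`(1/2π)∫ Γ(α+s)Γ(β+s)Γ(μ−s)/Γ(c+μ+s)·e^{iεπs} dy = (−1)^μ · Γ(α+μ)Γ(β+μ)Γ(c−α−β)/(Γ(c−β+μ)Γ(c−α+μ))`, `s = −t₀+iy`
(g27's `barnes_exp_eq_Gamma` with `t₀+μ`, `α+μ`, `β+μ`, `c+2μ` after the reindexing `s = s' + μ`). -/
theorem inner_barnes_eq (ht₀ : 0 < t₀) (hα : t₀ < α.re) (hβ : t₀ < β.re) {c : ℂ} (hc : α.re + β.re < c.re)
    {ε : ℝ} (hε : ε = 1 ∨ ε = -1) (μ : ℕ) :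
    (1 / (2 * π) : ℂ) * ∫ y : ℝ,
        Complex.Gamma (α + (-(t₀ : ℂ) + (y : ℂ) * Complex.I)) * Complex.Gamma (β + (-(t₀ : ℂ) + (y : ℂ) * Complex.I)) *
            Complex.Gamma ((μ : ℂ) - (-(t₀ : ℂ) + (y : ℂ) * Complex.I)) /
            Complex.Gamma (c + μ + (-(t₀ : ℂ) + (y : ℂ) * Complex.I)) *
          Complex.exp (ε * π * Complex.I * (-(t₀ : ℂ) + (y : ℂ) * Complex.I)) =
      (-1 : ℂ) ^ μ * (Complex.Gamma (α + μ) * Complex.Gamma (β + μ) * Complex.Gamma (c - α - β) /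
        (Complex.Gamma (c - β + μ) * Complex.Gamma (c - α + μ))) := by
  have hμ : (0 : ℝ) ≤ μ := μ.cast_nonneg
  have h := BarnesEulerIntegralCut.barnes_exp_eq_Gamma (t₀ := t₀ + μ) (a₀ := α + μ) (a := β + μ) (b := c + 2 * μ)
    (by positivity) (by simp; linarith) (by simp; linarith) (by simp; linarith) hε
  have g1 : c + 2 * (μ : ℂ) - (β + μ) - (α + μ) = c - α - β := by ring
  have g2 : c + 2 * (μ : ℂ) - (β + μ) = c - β + μ := by ring
  have g3 : c + 2 * (μ : ℂ) - (α + μ) = c - α + μ := by ring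
  rw [g1, g2, g3] at h
  -- pointwise reindexing `s = s' + μ`
  have hpt : ∀ y : ℝ,
      Complex.Gamma (α + (-(t₀ : ℂ) + (y : ℂ) * Complex.I)) * Complex.Gamma (β + (-(t₀ : ℂ) + (y : ℂ) * Complex.I)) *
            Complex.Gamma ((μ : ℂ) - (-(t₀ : ℂ) + (y : ℂ) * Complex.I)) /
            Complex.Gamma (c + μ + (-(t₀ : ℂ) + (y : ℂ) * Complex.I)) *
          Complex.exp (ε * π * Complex.I * (-(t₀ : ℂ) + (y : ℂ) * Complex.I)) =
        Complex.Gamma (α + μ + (-((t₀ + μ : ℝ) : ℂ) + (y : ℂ) * Complex.I)) *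
              Complex.Gamma (β + μ + (-((t₀ + μ : ℝ) : ℂ) + (y : ℂ) * Complex.I)) *
              Complex.Gamma (-(-((t₀ + μ : ℝ) : ℂ) + (y : ℂ) * Complex.I)) /
              Complex.Gamma (c + 2 * μ + (-((t₀ + μ : ℝ) : ℂ) + (y : ℂ) * Complex.I)) *
            Complex.exp (ε * π * Complex.I * (-((t₀ + μ : ℝ) : ℂ) + (y : ℂ) * Complex.I)) *
          Complex.exp (ε * π * Complex.I * μ) := by
    intro y
    have e1 : α + (-(t₀ : ℂ) + (y : ℂ) * Complex.I) = α + μ + (-((t₀ + μ : ℝ) : ℂ) + (y : ℂ) * Complex.I) := by push_cast; ring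
    have e2 : β + (-(t₀ : ℂ) + (y : ℂ) * Complex.I) = β + μ + (-((t₀ + μ : ℝ) : ℂ) + (y : ℂ) * Complex.I) := by push_cast; ring
    have e3 : (μ : ℂ) - (-(t₀ : ℂ) + (y : ℂ) * Complex.I) = -(-((t₀ + μ : ℝ) : ℂ) + (y : ℂ) * Complex.I) := by push_cast; ring
    have e4 : c + μ + (-(t₀ : ℂ) + (y : ℂ) * Complex.I) = c + 2 * μ + (-((t₀ + μ : ℝ) : ℂ) + (y : ℂ) * Complex.I) := by
      push_cast; ring
    have e5 : Complex.exp (ε * π * Complex.I * (-(t₀ : ℂ) + (y : ℂ) * Complex.I)) =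
        Complex.exp (ε * π * Complex.I * (-((t₀ + μ : ℝ) : ℂ) + (y : ℂ) * Complex.I)) * Complex.exp (ε * π * Complex.I * μ) := by
      rw [← Complex.exp_add]; push_cast; ring_nf
    rw [e1, e2, e3, e4, e5]; ring
  have hI : (∫ y : ℝ,
        Complex.Gamma (α + (-(t₀ : ℂ) + (y : ℂ) * Complex.I)) * Complex.Gamma (β + (-(t₀ : ℂ) + (y : ℂ) * Complex.I)) *
            Complex.Gamma ((μ : ℂ) - (-(t₀ : ℂ) + (y : ℂ) * Complex.I)) /
            Complex.Gamma (c + μ + (-(t₀ : ℂ) + (y : ℂ) * Complex.I)) *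
          Complex.exp (ε * π * Complex.I * (-(t₀ : ℂ) + (y : ℂ) * Complex.I))) =
      (∫ y : ℝ, Complex.Gamma (α + μ + (-((t₀ + μ : ℝ) : ℂ) + (y : ℂ) * Complex.I)) *
              Complex.Gamma (β + μ + (-((t₀ + μ : ℝ) : ℂ) + (y : ℂ) * Complex.I)) *
              Complex.Gamma (-(-((t₀ + μ : ℝ) : ℂ) + (y : ℂ) * Complex.I)) /
              Complex.Gamma (c + 2 * μ + (-((t₀ + μ : ℝ) : ℂ) + (y : ℂ) * Complex.I)) *
            Complex.exp (ε * π * Complex.I * (-((t₀ + μ : ℝ) : ℂ) + (y : ℂ) * Complex.I))) *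
        Complex.exp (ε * π * Complex.I * μ) := by
    rw [← integral_mul_const]
    exact integral_congr_ae (Eventually.of_forall hpt)
  rw [hI, ← mul_assoc, h, exp_phase_nat hε, mul_comm]

/-! ### 2. A bound uniform in `μ` -/

/-- **Uniform bound for the inner integrand** (real `c ≥ 2t₀`, `|ε| ≤ 1`): there is `C > 0` with
`‖Γ(α+s)Γ(β+s)Γ(μ−s)/Γ(c+μ+s)·e^{iεπs}‖ ≤ C·(‖Γ(α+s)Γ(β+s)‖e^{π|y|})·‖(c−t₀+μ)+iy‖^{−(c−2t₀)}` for all `μ : ℕ`, `y : ℝ`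
(`GammaRatioUniform`: the ratio `Γ(μ+t₀−iy)/Γ(c+μ−t₀+iy)` has the decay of Stirling UNIFORMLY in `μ`). -/
theorem norm_inner_le (ht₀ : 0 < t₀) {c : ℝ} (hc : 2 * t₀ ≤ c) {ε : ℝ} (hε : |ε| ≤ 1) :
    ∃ C : ℝ, 0 < C ∧ ∀ (μ : ℕ) (y : ℝ),
      ‖Complex.Gamma (α + (-(t₀ : ℂ) + (y : ℂ) * Complex.I)) * Complex.Gamma (β + (-(t₀ : ℂ) + (y : ℂ) * Complex.I)) *
            Complex.Gamma ((μ : ℂ) - (-(t₀ : ℂ) + (y : ℂ) * Complex.I)) /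
            Complex.Gamma ((c : ℂ) + μ + (-(t₀ : ℂ) + (y : ℂ) * Complex.I)) *
          Complex.exp (ε * π * Complex.I * (-(t₀ : ℂ) + (y : ℂ) * Complex.I))‖ ≤
        C * (‖Complex.Gamma (α + (-(t₀ : ℂ) + (y : ℂ) * Complex.I)) * Complex.Gamma (β + (-(t₀ : ℂ) + (y : ℂ) * Complex.I))‖ *
          Real.exp (π * |y|)) * ‖((c - t₀ + μ : ℝ) : ℂ) + (y : ℂ) * Complex.I‖ ^ (-(c - 2 * t₀)) := by
  obtain ⟨C, hC, h⟩ := exists_norm_Gamma_conj_div_le (x₀ := t₀) (d := c - 2 * t₀) ht₀ (by linarith)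
  refine ⟨C, hC, fun μ y => ?_⟩
  have hx : t₀ ≤ (μ : ℝ) + t₀ := by linarith [μ.cast_nonneg (α := ℝ)]
  have hr := h ((μ : ℝ) + t₀) y hx
  have e1 : (μ : ℂ) - (-(t₀ : ℂ) + (y : ℂ) * Complex.I) = (((μ : ℝ) + t₀ : ℝ) : ℂ) - (y : ℂ) * Complex.I := by push_cast; ring
  have e2 : (c : ℂ) + μ + (-(t₀ : ℂ) + (y : ℂ) * Complex.I) = (((μ : ℝ) + t₀ : ℝ) : ℂ) + ((c - 2 * t₀ : ℝ) : ℂ) + (y : ℂ) * Complex.I := by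
    push_cast; ring
  have e3 : (((μ : ℝ) + t₀ : ℝ) : ℂ) + ((c - 2 * t₀ : ℝ) : ℂ) + (y : ℂ) * Complex.I = ((c - t₀ + μ : ℝ) : ℂ) + (y : ℂ) * Complex.I := by
    push_cast; ring
  rw [e3] at hr
  have hph := norm_phase_le hε (-(t₀ : ℂ) + (y : ℂ) * Complex.I)
  simp only [Complex.add_im, Complex.neg_im, Complex.ofReal_im, neg_zero, Complex.mul_im, Complex.I_re, Complex.I_im,
    Complex.ofReal_re, mul_zero, mul_one, zero_add, add_zero] at hph
  rw [mul_div_assoc, e1, e2, e3, norm_mul, norm_mul]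
  set G := ‖Complex.Gamma (α + (-(t₀ : ℂ) + (y : ℂ) * Complex.I)) * Complex.Gamma (β + (-(t₀ : ℂ) + (y : ℂ) * Complex.I))‖
  calc G * ‖Complex.Gamma ((((μ : ℝ) + t₀ : ℝ) : ℂ) - (y : ℂ) * Complex.I) /
          Complex.Gamma (((c - t₀ + μ : ℝ) : ℂ) + (y : ℂ) * Complex.I)‖ *
        ‖Complex.exp (ε * π * Complex.I * (-(t₀ : ℂ) + (y : ℂ) * Complex.I))‖
      ≤ G * (C * ‖((c - t₀ + μ : ℝ) : ℂ) + (y : ℂ) * Complex.I‖ ^ (-(c - 2 * t₀))) * Real.exp (π * |y|) := by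
        gcongr
    _ = _ := by ring

/-- For `|y| ≥ 1` and real `q`: `(1+|y|)^{−q} ≤ 2^{|q|} |y|^{−q}`. -/
theorem one_add_abs_rpow_neg_le (q : ℝ) {y : ℝ} (hy : 1 ≤ |y|) : (1 + |y|) ^ (-q) ≤ (2 : ℝ) ^ |q| * |y| ^ (-q) := by
  have hy0 : 0 < |y| := by linarith
  rcases le_or_gt 0 q with hq | hq
  · rw [abs_of_nonneg hq]
    calc (1 + |y|) ^ (-q) ≤ |y| ^ (-q) := Real.rpow_le_rpow_of_nonpos hy0 (by linarith) (by linarith)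
      _ ≤ (2 : ℝ) ^ q * |y| ^ (-q) := le_mul_of_one_le_left (Real.rpow_nonneg hy0.le _) (Real.one_le_rpow (by norm_num) hq)
  · rw [abs_of_neg hq]
    calc (1 + |y|) ^ (-q) ≤ (2 * |y|) ^ (-q) := Real.rpow_le_rpow (by positivity) (by linarith) (by linarith)
      _ = (2 : ℝ) ^ (-q) * |y| ^ (-q) := Real.mul_rpow (by norm_num) hy0.le

/-- **Integrability of the two-Gamma weight**: for `t₀ < Re α`, `t₀ < Re β` and `q > Re α + Re β − 2t₀`,
`y ↦ ‖Γ(α+s)Γ(β+s)·(1+|y|)^{−q}‖·e^{π|y|}` is integrable (`s = −t₀+iy`; the two Stirling factors give `|y|^{Re α+Re β−2t₀−1}e^{−π|y|}`). -/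
theorem integrable_two_Gamma_weight (hα : t₀ < α.re) (hβ : t₀ < β.re) {q : ℝ} (hq : α.re + β.re - 2 * t₀ < q) :
    Integrable fun y : ℝ =>
      ‖Complex.Gamma (α + (-(t₀ : ℂ) + (y : ℂ) * Complex.I)) * Complex.Gamma (β + (-(t₀ : ℂ) + (y : ℂ) * Complex.I)) *
          (((1 + |y|) ^ (-q) : ℝ) : ℂ)‖ * Real.exp (π * |y|) := by
  obtain ⟨C₁, hC₁, R₁, hR₁, h₁⟩ := norm_Gamma_shift_le α t₀
  obtain ⟨C₂, hC₂, R₂, hR₂, h₂⟩ := norm_Gamma_shift_le β t₀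
  have hcont : Continuous fun y : ℝ =>
      Complex.Gamma (α + (-(t₀ : ℂ) + (y : ℂ) * Complex.I)) * Complex.Gamma (β + (-(t₀ : ℂ) + (y : ℂ) * Complex.I)) *
        (((1 + |y|) ^ (-q) : ℝ) : ℂ) := by
    have hΓ : ∀ (f : ℝ → ℂ), Continuous f → (∀ y, 0 < (f y).re) → Continuous fun y => Complex.Gamma (f y) := by
      intro f hf hpos
      refine continuous_iff_continuousAt.mpr fun y => (Complex.continuousAt_Gamma _ ?_).comp hf.continuousAt
      exact ne_neg_nat_of_re_pos (hpos y)
    refine ((hΓ _ (by fun_prop) fun y => by simp; linarith).mul (hΓ _ (by fun_prop) fun y => by simp; linarith)).mul ?_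
    exact Complex.continuous_ofReal.comp ((continuous_const.add continuous_abs).rpow_const fun y =>
      Or.inl (by positivity : (0 : ℝ) < 1 + |y|).ne')
  refine integrable_norm_mul_exp_pi_of_tail hcont (C := C₁ * C₂ * (2 : ℝ) ^ |q|)
    (E := (α.re - t₀ - 1 / 2) + (β.re - t₀ - 1 / 2) + -q) (R := max R₁ R₂) (le_max_of_le_left hR₁) (by linarith)
    fun y hy => ?_
  have hy₁ : R₁ ≤ |y| := le_trans (le_max_left _ _) hy
  have hy₂ : R₂ ≤ |y| := le_trans (le_max_right _ _) hy
  have hy1 : 1 ≤ |y| := le_trans hR₁ hy₁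
  have hy0 : 0 < |y| := by linarith
  have g1 := h₁ y hy₁
  have g2 := h₂ y hy₂
  have g3 : ‖(((1 + |y|) ^ (-q) : ℝ) : ℂ)‖ ≤ (2 : ℝ) ^ |q| * |y| ^ (-q) := by
    rw [Complex.norm_real, Real.norm_eq_abs, abs_of_nonneg (Real.rpow_nonneg (by positivity) _)]
    exact one_add_abs_rpow_neg_le q hy1
  rw [norm_mul, norm_mul]
  calc ‖Complex.Gamma (α + (-(t₀ : ℂ) + (y : ℂ) * Complex.I))‖ * ‖Complex.Gamma (β + (-(t₀ : ℂ) + (y : ℂ) * Complex.I))‖ *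
          ‖(((1 + |y|) ^ (-q) : ℝ) : ℂ)‖
      ≤ (C₁ * |y| ^ (α.re - t₀ - 1 / 2) * Real.exp (-(π * |y|) / 2)) * (C₂ * |y| ^ (β.re - t₀ - 1 / 2) * Real.exp (-(π * |y|) / 2)) *
          ((2 : ℝ) ^ |q| * |y| ^ (-q)) := by gcongr
    _ = C₁ * C₂ * (2 : ℝ) ^ |q| * (|y| ^ (α.re - t₀ - 1 / 2) * |y| ^ (β.re - t₀ - 1 / 2) * |y| ^ (-q)) *
          (Real.exp (-(π * |y|) / 2) * Real.exp (-(π * |y|) / 2)) := by ring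
    _ = C₁ * C₂ * (2 : ℝ) ^ |q| * |y| ^ ((α.re - t₀ - 1 / 2) + (β.re - t₀ - 1 / 2) + -q) * Real.exp (-(π * |y|)) := by
        rw [← Real.rpow_add hy0, ← Real.rpow_add hy0, ← Real.exp_add]; ring_nf

/-- **The `μ`-uniform bound for the inner integrals**: for real `c` with `2t₀ ≤ c`, `1 ≤ c − t₀`, `0 < t₀ < Re α, Re β`, `|ε| ≤ 1`,
and `θ ≥ 0` with `Re α + Re β − 2t₀ < (c − 2t₀)(1 − θ)`, there is `C > 0` such that for EVERY `μ : ℕ` the inner integrand is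
integrable and `∫‖Γ(α+s)Γ(β+s)Γ(μ−s)/Γ(c+μ+s)·e^{iεπs}‖ dy ≤ C·(c − t₀ + μ)^{−(c−2t₀)θ}` (`θ ≤ 1` is the useful range). -/
theorem exists_integral_norm_inner_le (ht₀ : 0 < t₀) (hα : t₀ < α.re) (hβ : t₀ < β.re) {c : ℝ} (hc : 2 * t₀ ≤ c)
    (hc1 : 1 ≤ c - t₀) {ε : ℝ} (hε : |ε| ≤ 1) {θ : ℝ} (hθ0 : 0 ≤ θ)
    (hq : α.re + β.re - 2 * t₀ < (c - 2 * t₀) * (1 - θ)) :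
    ∃ C : ℝ, 0 < C ∧ ∀ μ : ℕ,
      Integrable (fun y : ℝ =>
        Complex.Gamma (α + (-(t₀ : ℂ) + (y : ℂ) * Complex.I)) * Complex.Gamma (β + (-(t₀ : ℂ) + (y : ℂ) * Complex.I)) *
            Complex.Gamma ((μ : ℂ) - (-(t₀ : ℂ) + (y : ℂ) * Complex.I)) /
            Complex.Gamma ((c : ℂ) + μ + (-(t₀ : ℂ) + (y : ℂ) * Complex.I)) *
          Complex.exp (ε * π * Complex.I * (-(t₀ : ℂ) + (y : ℂ) * Complex.I))) ∧
      ∫ y : ℝ, ‖Complex.Gamma (α + (-(t₀ : ℂ) + (y : ℂ) * Complex.I)) * Complex.Gamma (β + (-(t₀ : ℂ) + (y : ℂ) * Complex.I)) *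
            Complex.Gamma ((μ : ℂ) - (-(t₀ : ℂ) + (y : ℂ) * Complex.I)) /
            Complex.Gamma ((c : ℂ) + μ + (-(t₀ : ℂ) + (y : ℂ) * Complex.I)) *
          Complex.exp (ε * π * Complex.I * (-(t₀ : ℂ) + (y : ℂ) * Complex.I))‖ ≤
        C * (c - t₀ + μ) ^ (-((c - 2 * t₀) * θ)) := by
  set d : ℝ := c - 2 * t₀ with hd
  have hd0 : 0 ≤ d := by linarith
  obtain ⟨C₁, hC₁, hb⟩ := norm_inner_le (α := α) (β := β) ht₀ hc hε
  have hW := integrable_two_Gamma_weight (α := α) (β := β) hα hβ (q := d * (1 - θ)) (by linarith)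
  set I₀ : ℝ := ∫ y : ℝ, ‖Complex.Gamma (α + (-(t₀ : ℂ) + (y : ℂ) * Complex.I)) * Complex.Gamma (β + (-(t₀ : ℂ) + (y : ℂ) * Complex.I)) *
      (((1 + |y|) ^ (-(d * (1 - θ))) : ℝ) : ℂ)‖ * Real.exp (π * |y|) with hI₀
  have hI₀0 : 0 ≤ I₀ := integral_nonneg fun y => by positivity
  refine ⟨C₁ * (2 : ℝ) ^ (d * (1 - θ)) * (I₀ + 1), by positivity, fun μ => ?_⟩
  have hμ : (0 : ℝ) ≤ μ := μ.cast_nonneg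
  have hRe : 1 ≤ c - t₀ + μ := by linarith
  -- the pointwise majorant
  set M : ℝ := C₁ * (2 : ℝ) ^ (d * (1 - θ)) * (c - t₀ + μ) ^ (-(d * θ)) with hM
  have hmaj : ∀ y : ℝ,
      ‖Complex.Gamma (α + (-(t₀ : ℂ) + (y : ℂ) * Complex.I)) * Complex.Gamma (β + (-(t₀ : ℂ) + (y : ℂ) * Complex.I)) *
            Complex.Gamma ((μ : ℂ) - (-(t₀ : ℂ) + (y : ℂ) * Complex.I)) /
            Complex.Gamma ((c : ℂ) + μ + (-(t₀ : ℂ) + (y : ℂ) * Complex.I)) *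
          Complex.exp (ε * π * Complex.I * (-(t₀ : ℂ) + (y : ℂ) * Complex.I))‖ ≤
        M * (‖Complex.Gamma (α + (-(t₀ : ℂ) + (y : ℂ) * Complex.I)) * Complex.Gamma (β + (-(t₀ : ℂ) + (y : ℂ) * Complex.I)) *
          (((1 + |y|) ^ (-(d * (1 - θ))) : ℝ) : ℂ)‖ * Real.exp (π * |y|)) := by
    intro y
    set w : ℂ := ((c - t₀ + μ : ℝ) : ℂ) + (y : ℂ) * Complex.I with hw
    have hwre : w.re = c - t₀ + μ := by simp [hw]
    have hw1 : 1 ≤ ‖w‖ := le_trans hRe (by rw [← hwre]; exact Complex.re_le_norm w)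
    have hw0 : 0 < ‖w‖ := by linarith
    have hwy : (1 + |y|) / 2 ≤ ‖w‖ := by
      have : |y| ≤ ‖w‖ := by have := Complex.abs_im_le_norm w; simpa [hw] using this
      linarith
    -- `‖w‖^{-d} ≤ (Re w)^{-dθ} · ((1+|y|)/2)^{-d(1-θ)}`
    have hsplit : ‖w‖ ^ (-d) ≤ (c - t₀ + μ) ^ (-(d * θ)) * ((2 : ℝ) ^ (d * (1 - θ)) * (1 + |y|) ^ (-(d * (1 - θ)))) := by
      have e : ‖w‖ ^ (-d) = ‖w‖ ^ (-(d * θ)) * ‖w‖ ^ (-(d * (1 - θ))) := by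
        rw [← Real.rpow_add hw0]; ring_nf
      rw [e]
      have f1 : ‖w‖ ^ (-(d * θ)) ≤ (c - t₀ + μ) ^ (-(d * θ)) :=
        Real.rpow_le_rpow_of_nonpos (by linarith) (by rw [← hwre]; exact Complex.re_le_norm w)
          (by nlinarith)
      have f2 : ‖w‖ ^ (-(d * (1 - θ))) ≤ ((1 + |y|) / 2) ^ (-(d * (1 - θ))) :=
        Real.rpow_le_rpow_of_nonpos (by positivity) hwy (by nlinarith)
      have f3 : ((1 + |y|) / 2) ^ (-(d * (1 - θ))) = (2 : ℝ) ^ (d * (1 - θ)) * (1 + |y|) ^ (-(d * (1 - θ))) := by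
        rw [Real.div_rpow (by positivity) (by norm_num), Real.rpow_neg (by norm_num : (0 : ℝ) ≤ 2), div_eq_mul_inv, inv_inv,
          mul_comm]
      rw [← f3]
      exact mul_le_mul f1 f2 (Real.rpow_nonneg hw0.le _) (Real.rpow_nonneg (by linarith) _)
    have hG0 : 0 ≤ ‖Complex.Gamma (α + (-(t₀ : ℂ) + (y : ℂ) * Complex.I)) * Complex.Gamma (β + (-(t₀ : ℂ) + (y : ℂ) * Complex.I))‖ *
        Real.exp (π * |y|) := by positivity
    have hnw : ‖(((1 + |y|) ^ (-(d * (1 - θ))) : ℝ) : ℂ)‖ = (1 + |y|) ^ (-(d * (1 - θ))) := by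
      rw [Complex.norm_real, Real.norm_eq_abs, abs_of_nonneg (Real.rpow_nonneg (by positivity) _)]
    calc _ ≤ C₁ * (‖Complex.Gamma (α + (-(t₀ : ℂ) + (y : ℂ) * Complex.I)) * Complex.Gamma (β + (-(t₀ : ℂ) + (y : ℂ) * Complex.I))‖ *
            Real.exp (π * |y|)) * ‖w‖ ^ (-d) := hb μ y
      _ ≤ C₁ * (‖Complex.Gamma (α + (-(t₀ : ℂ) + (y : ℂ) * Complex.I)) * Complex.Gamma (β + (-(t₀ : ℂ) + (y : ℂ) * Complex.I))‖ *
            Real.exp (π * |y|)) * ((c - t₀ + μ) ^ (-(d * θ)) * ((2 : ℝ) ^ (d * (1 - θ)) * (1 + |y|) ^ (-(d * (1 - θ))))) :=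
          mul_le_mul_of_nonneg_left hsplit (mul_nonneg hC₁.le hG0)
      _ = _ := by
          have hn2 : ‖Complex.Gamma (α + (-(t₀ : ℂ) + (y : ℂ) * Complex.I)) * Complex.Gamma (β + (-(t₀ : ℂ) + (y : ℂ) * Complex.I)) *
              (((1 + |y|) ^ (-(d * (1 - θ))) : ℝ) : ℂ)‖ =
              ‖Complex.Gamma (α + (-(t₀ : ℂ) + (y : ℂ) * Complex.I)) * Complex.Gamma (β + (-(t₀ : ℂ) + (y : ℂ) * Complex.I))‖ *
                (1 + |y|) ^ (-(d * (1 - θ))) := by rw [norm_mul, hnw]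
          rw [hM, hn2]; ring
  -- continuity of the inner integrand (no pole on the line)
  have hcont : Continuous fun y : ℝ =>
      Complex.Gamma (α + (-(t₀ : ℂ) + (y : ℂ) * Complex.I)) * Complex.Gamma (β + (-(t₀ : ℂ) + (y : ℂ) * Complex.I)) *
          Complex.Gamma ((μ : ℂ) - (-(t₀ : ℂ) + (y : ℂ) * Complex.I)) /
          Complex.Gamma ((c : ℂ) + μ + (-(t₀ : ℂ) + (y : ℂ) * Complex.I)) *
        Complex.exp (ε * π * Complex.I * (-(t₀ : ℂ) + (y : ℂ) * Complex.I)) := by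
    have hΓ : ∀ (f : ℝ → ℂ), Continuous f → (∀ y, 0 < (f y).re) → Continuous fun y => Complex.Gamma (f y) := by
      intro f hf hpos
      refine continuous_iff_continuousAt.mpr fun y => (Complex.continuousAt_Gamma _ ?_).comp hf.continuousAt
      exact ne_neg_nat_of_re_pos (hpos y)
    refine (((((hΓ _ (by fun_prop) fun y => by simp; linarith).mul (hΓ _ (by fun_prop) fun y => by simp; linarith)).mul
      (hΓ _ (by fun_prop) fun y => by simp; linarith)).div (hΓ _ (by fun_prop) fun y => by simp; linarith) fun y => ?_).mul
      (by fun_prop))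
    exact Complex.Gamma_ne_zero_of_re_pos (by simp; linarith)
  have hint : Integrable (fun y : ℝ =>
      Complex.Gamma (α + (-(t₀ : ℂ) + (y : ℂ) * Complex.I)) * Complex.Gamma (β + (-(t₀ : ℂ) + (y : ℂ) * Complex.I)) *
          Complex.Gamma ((μ : ℂ) - (-(t₀ : ℂ) + (y : ℂ) * Complex.I)) /
          Complex.Gamma ((c : ℂ) + μ + (-(t₀ : ℂ) + (y : ℂ) * Complex.I)) *
        Complex.exp (ε * π * Complex.I * (-(t₀ : ℂ) + (y : ℂ) * Complex.I))) :=
    (hW.const_mul M).mono' hcont.aestronglyMeasurable (Eventually.of_forall hmaj)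
  refine ⟨hint, ?_⟩
  calc _ ≤ ∫ y : ℝ, M * (‖Complex.Gamma (α + (-(t₀ : ℂ) + (y : ℂ) * Complex.I)) *
            Complex.Gamma (β + (-(t₀ : ℂ) + (y : ℂ) * Complex.I)) * (((1 + |y|) ^ (-(d * (1 - θ))) : ℝ) : ℂ)‖ * Real.exp (π * |y|)) :=
        integral_mono_of_nonneg (Eventually.of_forall fun y => norm_nonneg _) (hW.const_mul M) (Eventually.of_forall hmaj)
    _ = M * I₀ := by rw [integral_const_mul]
    _ ≤ M * (I₀ + 1) := mul_le_mul_of_nonneg_left (by linarith) (by positivity)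
    _ = C₁ * (2 : ℝ) ^ (d * (1 - θ)) * (I₀ + 1) * (c - t₀ + μ) ^ (-(d * θ)) := by rw [hM]; ring
    _ = _ := by rw [hd]

end Summit.KontsevichZagierPeriods.Zeta5Search.VWPInnerBarnes

end
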